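import Summits.BirchSwinnertonDyer.BirchSwinnertonDyer.Theses.SignedLowerHalves
import Summits.BirchSwinnertonDyer.BirchSwinnertonDyer.Theorems.SignedLowerHalvesKobayashiLowerHalfLargeImageMuPartSqueeze
import HarnessLib

/-!
# Route `SignedLowerHalves`, crux 3 `KobayashiLowerHalfLargeImage` (item stmt-BirchSwinnertonDyer-19001):
# PLACEMENT — crux 3 BY NAME ⟺ its restriction to the pairs where BOTH signed `p`-adic `L`-functions have `λ > rank E(ℚ)`
# (the «rank stratum» is settled for both signs by the sign-blind squeeze; no μ-stratum is left)
# (cell `bsd-ssimc`, width seat `bsd-line-slh-p1-w6` gen 0; `--supports 19001`; CALIBRATION ONLY; imports the route file)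

HONEST FRAMING.  The crux is OPEN and nothing here proves it; BSD is not proved by any of this.  CONDITIONAL on the PUBLISHED named
facts `h12`, `h41`, `h5`, `h3`, `hJ` and — only at `p ≥ 5` — Conjecture B⁰.  This sharpens the LEAD's parity-stratum calibration
(`LargeImageParityStratumCrux.kobayashiLowerHalfLargeImage_iff_offStratum'`, gen 12: the crux lives on the pairs where for BOTH signs
`μ(L_p^ε) ≥ 1` or `λ(L_p^ε) ≥ 2`) in two ways: the alternative `μ ≥ 1` is GONE (μ-floor + μ-part: the μ-step is free for both signs),
and `λ ≤ 1` (with `p`-parity) is replaced by `λ ≤ rank E(ℚ)` for ONE sign (with the Mordell–Weil rank; the sign-blind squeeze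
`LargeImageMuPartSqueeze.kobayashiMainConjecture_forall_of_lam_le_mordellWeilRank_of_teichSpanGenAll`).

* `kobayashiLowerHalfLargeImage_iff_offRankStratum` — crux 3 BY NAME ⟺ «crux 3 on the pairs with `rank E(ℚ) < λ(L_p^ε)` for every
  sign and every Pollack pair of the newform» (facts + B⁰).
* `kuriharaRigidity_stub_three_iff_offRankStratum` — the same for the REGISTERED residue `stub_three` of the line of record at
  `p = 3`, modulo PUBLISHED facts only.
Since `λ(L_p^ε) ≥ ord_T L_p^ε ≥` (conjecturally `=`) `rank`, the residual population is «both signs have EXTRA zeros beyond the rank»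
(paired non-cyclotomic zeros or cyclotomic zeros of higher layers — Kurihara–Pollack's `e_n`); per pair decidable from one Mazur–Tate
element per parity and a basis of `E(ℚ)`.  CALIBRATION / SUPPORT ONLY (pen rule D34-4 (3)).

References: [Kobayashi2003] Conjecture (p. 2), Thm. 1.2, Thm. 4.1; [GreenbergLNM1716] §3 Lemma 3.1; [KuriharaPollack2007] §1, Problem 3.2;
[PollackWeston2011] Rem. 4.2; [Vaserstein1972SL2] Theorem.
-/

-- D-0017: single-problem summit, the namespace repeats the problem name by design.
set_option linter.dupNamespace false
set_option autoImplicit false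

noncomputable section

open scoped Classical MatrixGroups ModularForm

open CongruenceSubgroup WeierstrassCurve Literature.NumberTheory.EllipticCurves
  Literature.NumberTheory.EllipticCurves.ModularForms
  Literature.NumberTheory.EllipticCurves.Kobayashi2003 Literature.NumberTheory.EllipticCurves.GreenbergVatsal2000
  Literature.NumberTheory.EllipticCurves.Rank1Residual ZpExtension
  Summit.BirchSwinnertonDyer.Rank1Residual.Supersingular

namespace Summit.BirchSwinnertonDyer.BirchSwinnertonDyer.Theorems.LargeImageMuPartSqueezeCrux

open Summit.BirchSwinnertonDyer.Rank1Residual.X1.MuLambda (lam)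
open Summit.BirchSwinnertonDyer.BirchSwinnertonDyer.Cruxes.AnalyticMuZeroX9.TeichSpan (TeichSpanGenAll)
open Summit.BirchSwinnertonDyer.BirchSwinnertonDyer.Theorems.LargeImageMuPartSqueeze
  (kobayashiMainConjecture_forall_of_lam_le_mordellWeilRank_of_teichSpanGenAll
    kobayashiMainConjecture_forall_of_lam_le_mordellWeilRank_three)

section Placement

variable {p : ℕ} [Fact p.Prime] {W : WeierstrassCurve ℚ}

/-- From ONE witness `(f₀, L₀⁺, L₀⁻, ε₁)` with `λ(kobayashiL ε₁ L₀⁺ L₀⁻) ≤ rank E(ℚ)` to the certificate shape of the squeeze (every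
newform, every Pollack pair): newforms of `W` coincide (`IsNewformOf.unique`) and Pollack's `L_p^{ε₁}` is unique
(`IsSignedPAdicLFunction.unique`). [cite: Kobayashi2003, Thm. 3.2 (p. 7)] [cite: Pollack2003, Prop. 6.18] -/
theorem cert_of_witness [NeZero (W.conductorNorm ℤ)] {f₀ : CuspForm (Gamma0 (W.conductorNorm ℤ)) 2}
    (hf₀ : IsNewformOf W f₀) {L₀plus L₀minus : IwasawaAlgebra p} (hPP₀ : IsPollackPair f₀ p L₀plus L₀minus) {ε₁ : ℤˣ}
    (h : lam (kobayashiL ε₁ L₀plus L₀minus) ≤ W.mordellWeilRank) :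
    ∀ (f : CuspForm (Gamma0 (W.conductorNorm ℤ)) 2),
      IsNewformOf W f → ∀ Lplus Lminus : IwasawaAlgebra p, IsPollackPair f p Lplus Lminus →
        lam (kobayashiL ε₁ Lplus Lminus) ≤ W.mordellWeilRank := by
  intro f hf Lplus Lminus hPP
  have hff : f = f₀ := hf.unique hf₀
  subst hff
  have hL : kobayashiL ε₁ Lplus Lminus = kobayashiL ε₁ L₀plus L₀minus :=
    (hPP.isSignedPAdicLFunction_kobayashiL ε₁).unique (hPP₀.isSignedPAdicLFunction_kobayashiL ε₁)
  rw [hL]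
  exact h

end Placement

section Crux

/-- **PLACEMENT: crux 3 BY NAME ⟺ crux 3 on the pairs where BOTH signs have `λ(L_p^ε) > rank E(ℚ)`.**  GRANTED the published
facts `h12`, `h41`, `h5`, `h3`, `hJ` and B⁰ (only `p ≥ 5`).  On the complementary pairs (SOME sign, SOME Pollack pair of SOME newform
with `λ(L_p^ε) ≤ rank E(ℚ)`) the sign-blind squeeze gives Kobayashi's main conjecture for both signs, hence the crux's conclusion.
CALIBRATION ONLY. [cite: Kobayashi2003, Conjecture (p. 2), Thm. 4.1] [cite: GreenbergLNM1716, §3 Lemma 3.1] [cite: PollackWeston2011, Rem. 4.2] -/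
theorem kobayashiLowerHalfLargeImage_iff_offRankStratum
    (h12 : Kobayashi2003.thm12_signedSelmerDual_finite_torsion)
    (h41 : Kobayashi2003.thm41_signedCharIdeal_divisibility)
    (h5 : realPeriodRat_eq_unit_mul_plusPeriod) (h3 : realPeriodRat_eq_unit_mul_plusPeriod_three)
    (hJ : Kobayashi2003.thm62_63_73_signedColemanKato_zetaJoint) (hB : TeichSpanGenAll) :
    Summit.BirchSwinnertonDyer.BirchSwinnertonDyer.Theses.SignedLowerHalves.KobayashiLowerHalfLargeImage ↔
    ∀ (W : WeierstrassCurve ℚ) [W.IsElliptic] [W.IsGloballyMinimal] (p : ℕ) [Fact p.Prime],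
      p ≠ 2 → ClassX7 W p → ¬ W.HasCM → W.frobeniusTrace p = 0 → Surj W p →
      (∀ [NeZero (W.conductorNorm ℤ)] (f : CuspForm (Gamma0 (W.conductorNorm ℤ)) 2), IsNewformOf W f →
        ∀ (Lplus Lminus : IwasawaAlgebra p), IsPollackPair f p Lplus Lminus →
        ∀ ε : ℤˣ, W.mordellWeilRank < lam (kobayashiL ε Lplus Lminus)) →
      ∃ ε : ℤˣ, KobayashiLowerDivisibility W p ε := by
  constructor
  · intro h W _ _ p _ hp hX7 hCM hap hS _
    exact h W p hp hX7 hCM hap hS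
  · intro h W _ _ p _ hp hX7 hCM hap hS
    by_cases hw : ∃ (_ : NeZero (W.conductorNorm ℤ)) (f : CuspForm (Gamma0 (W.conductorNorm ℤ)) 2)
        (_ : IsNewformOf W f) (Lplus Lminus : IwasawaAlgebra p) (_ : IsPollackPair f p Lplus Lminus) (ε : ℤˣ),
        lam (kobayashiL ε Lplus Lminus) ≤ W.mordellWeilRank
    · obtain ⟨_, f₀, hf₀, L₀plus, L₀minus, hPP₀, ε₁, hle⟩ := hw
      exact ⟨ε₁, kobayashiLowerDivisibility_of_mainConjecture
        (kobayashiMainConjecture_forall_of_lam_le_mordellWeilRank_of_teichSpanGenAll h12 h41 h5 h3 hJ hB hp hX7.1.1 hap hS ε₁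
          (fun f hf Lplus Lminus hPP ↦ cert_of_witness hf₀ hPP₀ hle f hf Lplus Lminus hPP) ε₁)⟩
    · refine h W p hp hX7 hCM hap hS ?_
      intro _ f hf Lplus Lminus hPP ε
      by_contra hlt
      exact hw ⟨‹_›, f, hf, Lplus, Lminus, hPP, ε, not_lt.mp hlt⟩

/-- **PLACEMENT at `p = 3`, PUBLISHED facts only: the registered `KuriharaRigidity.stub_three` body ⟺ its restriction to the pairs
where both signs have `λ(L₃^ε) > rank E(ℚ)`.**  CALIBRATION ONLY (not a proof of the stub).
[cite: Kobayashi2003, Conjecture (p. 2), Thm. 4.1] [cite: GreenbergLNM1716, §3 Lemma 3.1] [cite: Vaserstein1972SL2, Theorem] -/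
theorem kuriharaRigidity_stub_three_iff_offRankStratum
    (h12 : Kobayashi2003.thm12_signedSelmerDual_finite_torsion)
    (h41 : Kobayashi2003.thm41_signedCharIdeal_divisibility)
    (h5 : realPeriodRat_eq_unit_mul_plusPeriod) (h3 : realPeriodRat_eq_unit_mul_plusPeriod_three)
    (hJ : Kobayashi2003.thm62_63_73_signedColemanKato_zetaJoint) :
    (∀ (W : WeierstrassCurve ℚ) [W.IsElliptic] [W.IsGloballyMinimal] (p : ℕ) [Fact p.Prime],
      p = 3 → ClassX7 W p → ¬ W.HasCM → W.frobeniusTrace p = 0 → Surj W p →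
      ∃ ε : ℤˣ, KobayashiLowerDivisibility W p ε) ↔
    ∀ (W : WeierstrassCurve ℚ) [W.IsElliptic] [W.IsGloballyMinimal] (p : ℕ) [Fact p.Prime],
      p = 3 → ClassX7 W p → ¬ W.HasCM → W.frobeniusTrace p = 0 → Surj W p →
      (∀ [NeZero (W.conductorNorm ℤ)] (f : CuspForm (Gamma0 (W.conductorNorm ℤ)) 2), IsNewformOf W f →
        ∀ (Lplus Lminus : IwasawaAlgebra p), IsPollackPair f p Lplus Lminus →
        ∀ ε : ℤˣ, W.mordellWeilRank < lam (kobayashiL ε Lplus Lminus)) →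
      ∃ ε : ℤˣ, KobayashiLowerDivisibility W p ε := by
  constructor
  · intro h W _ _ p _ hp hX7 hCM hap hS _
    exact h W p hp hX7 hCM hap hS
  · intro h W _ _ p _ hp3 hX7 hCM hap hS
    by_cases hw : ∃ (_ : NeZero (W.conductorNorm ℤ)) (f : CuspForm (Gamma0 (W.conductorNorm ℤ)) 2)
        (_ : IsNewformOf W f) (Lplus Lminus : IwasawaAlgebra p) (_ : IsPollackPair f p Lplus Lminus) (ε : ℤˣ),
        lam (kobayashiL ε Lplus Lminus) ≤ W.mordellWeilRank
    · obtain ⟨_, f₀, hf₀, L₀plus, L₀minus, hPP₀, ε₁, hle⟩ := hw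
      exact ⟨ε₁, kobayashiLowerDivisibility_of_mainConjecture
        (kobayashiMainConjecture_forall_of_lam_le_mordellWeilRank_three h12 h41 h5 h3 hJ hp3 hX7.1.1 hap hS ε₁
          (fun f hf Lplus Lminus hPP ↦ cert_of_witness hf₀ hPP₀ hle f hf Lplus Lminus hPP) ε₁)⟩
    · refine h W p hp3 hX7 hCM hap hS ?_
      intro _ f hf Lplus Lminus hPP ε
      by_contra hlt
      exact hw ⟨‹_›, f, hf, Lplus, Lminus, hPP, ε, not_lt.mp hlt⟩

end Crux

end Summit.BirchSwinnertonDyer.BirchSwinnertonDyer.Theorems.LargeImageMuPartSqueezeCrux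

end
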